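import Summits.QuantumFields.BalabanUV.Beta.D1BFx.GhostNeedleRootedLetters
import Summits.QuantumFields.BalabanUV.Beta.D1BFx.GhostLegMasses
import Summits.QuantumFields.BalabanUV.Beta.D1BFx.CoframeVertices

/-!
# `BalabanUV.Beta.D1BFx.PackedAveragingVertex` — road «BF-x» for binder row D1, slot (K), (J3)'s (C3) rows «THE FOUR `Q′`-WORDS, m-UNIFORM MASS»,
# FILE ε1 «PACKED AVERAGING VERTEX»: **THE PACKED AVERAGING CURRENT `Σ_κ wsum (w κ) (qAntiAt ρ n κ)` IS BLOCK-DIAGONAL OF RANK TWO,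
# `[blk x = blk z]·(F_w(z) − F_w(x))`, WITH A NEEDLE SUM `|F_w| ≤ 4n·n⁻⁴·(sup of the weights)`** — its pointwise size, localised row ∕ column sums,
# masses and total mass (the letters of the (C3) count, OWNER d1-p2 g20 INTENT-4 ∕ PART 16 `hMRB hCB`; the `Q′*Q′` table is ε1b)

HONEST DEPENDENCY (cell records, verbatim): «continuum YM on T⁴ ⇐ BetaPertH ∧ nine spine estimates (0/9 proved); BetaPertH ⇐ (D1) ∧ (D4) ∧
CAP+tail; G-an2-4 gates asym, D1 and NE2/3/4.»  HONEST FRAMING (cell contract, verbatim): «discharging `BetaPertH` makes Bałaban's UV stability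
UNCONDITIONAL — a real constructive-QFT result; it is NOT the continuum limit and NOT the Clay problem.»  THIS MODULE DISCHARGES NOTHING of the
wall: [folklore] finite combinatorics of the typed axial contour (d1-leaf-04 g6's CLOSED FORM `AveragingJetNeedle.gammaCoeff_eq_ite` BY NAME) and `ℓ¹`
bookkeeping in this lineage's α1∕α2 currency (`KernelMassCalculus` ∕ `KernelMassTotal`).  It introduces TWO [our object] abbreviations (`qF`, the needle sum of a
bond weight family seen from a fine site; `qV`, the packed averaging current) — definitions, asserting nothing, NOT claimed to be Bałaban's.  No `def … : Prop`,
nothing cited, 0 sorry.  0 root-level binders of row D1 discharged (hW ∕ hR-sockets ∕ hSX-socket ∕ D1Tel ∕ D1Rep = 0); (C3) NOT closed here; (K) NOT closed;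
NOT D1, NOT `BetaPertH`, NOT continuum, NOT Clay.

ABSOLUTE RULE (cell charter, verbatim): «No internally-minted statement may enter as a cited fact. Every hypothesis is either kernel-proved in
this package or a verbatim quotation of a PUBLISHED theorem with page reference. The manuscript(s) under audit are NOT citable for their own
disputed steps — they are the thing under adjudication; programme-internal (2001/route/tribunal) claims are never citable.»

WHY (OWNER d1-p2 g20 INTENT-4 l.44897, PART 16 `RoadEndBFxRoadScalesJ3S`: the (J3) rest is `(4N²n⁸ − 2)·PghQ(unit ray) + 2·BR n`, `BR n` = the four
`Q′`-words `½·tadpole (Ggh n a) 𝒲 − ½·(bubble Ggh 𝒱_D 𝒱_Q + bubble Ggh 𝒱_Q 𝒱_D + bubble Ggh 𝒱_Q 𝒱_Q)` at the road's dressed weights `w := colH G₀ n`; its rows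
`hMRB hCB` ask m-uniformly bounded (1.22) second moments; this lineage's located count W-2 l.45546).  The `Q′`-jet `qAntiAt ρ n κ u` is NOT local (it
lives on the whole block of `u`), so the δ-chain's local-vertex letters do not apply to `𝒱_Q := a•Σ_κ wsum (w κ) (qAntiAt ρ n κ)`; but it is RANK TWO per
block: `qAntiAt ρ n κ u x z = qJetAt(blk x) z − qJetAt(blk z) x` with `qJetAt ρ n κ u y x = [blk x = y = blk u]·n⁻⁴·γ(κ, u; n•y + ρ, x)`, so the packed current is
`[blk x = blk z]·(F_w(z) − F_w(x))` with the NEEDLE SUM `F_w(t) = n⁻⁴·Σ_κ Σ_{u ∈ B(blk t)} w κ u·γ(κ, u; root, t)`, and by the closed form of `γ` only the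
`≤ n` bonds of the κ-needle through `t` contribute: `|F_w(t)| ≤ 4n·n⁻⁴·sup_B |w|` — at the road's weights (`n⁻⁴·C_{G₀}`) `≍ n⁻⁷`, whence row∕column sums
`≍ n⁻³` (localised at the weights' centre) and total mass `≍ n` per block: the letters that make the (C3) cross words `O(n⁻¹)` against the leg's
mass and `O(n⁻³)` against its sup (FILE ε2).

CONTENT (all [folklore]; `d = 4`, `Site 4 = ℤ⁴`, block side `n ≥ 1`, `blk = B6QGQLower276.blk (n−1)`, `B (n−1) y` the block Finset; weights `w : Fin 4 → Site 4 → ℝ`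
with an envelope `|w κ u| ≤ C·e^{−δ|u−P|₁}`, `δ ≥ 0`, where stated).
* §1 `abs_gammaCoeff_le_ite` (the needle indicator dominates `|γ|`), **`sum_B_abs_gammaCoeff_le`** (`Σ_{u ∈ B y} |γ(κ,u; r, t)| ≤ n` for EVERY root `r`, endpoint `t`,
  block `y`: the bonds `u` of a block pinned in the three coordinates `j ≠ κ` inject into `Fin n` by `u_κ`).
* §2 [our object] `qF ρ n w t`; `qJet_term_eq_zero` ∕ `hasSum_qF_term` (finite support in the block), `qF_eq_sum`, **`abs_qF_le_of_sup`** (`≤ 4n·(n⁴)⁻¹·W`),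
  `weight_block_le` (a weight of the block of `t` is `≤ C·e^{4nδ}·e^{−δ|t−P|₁}`), **`abs_qF_le`** (`≤ 4n·(n⁴)⁻¹·(C·e^{4nδ})·e^{−δ|t−P|₁}`).
* §3 [our object] `qV ρ n w := (x z ↦ Σ_κ wsum (w κ) (qAntiAt ρ n κ) x z)`; **`qV_apply`** (the rank-two closed form), `qV_antisymm`, `trK_qV`, `qV_eq_zero_of_blk_ne`,
  **`abs_qV_le`** (`≤ 8n·(n⁴)⁻¹·C·e^{8nδ}·e^{−δ|x−P|₁}`), **`rows_qV`** ∕ **`cols_qV`** (`Σ' ≤ 8n·C·e^{8nδ}·e^{−δ|·−P|₁}`, the shape of α2's `totMass_sandwich`), `masses_qV`,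
  **`totMass_qV`** (`8n·C·e^{8nδ}·Zl 4 δ`, `δ > 0`).
NOT HERE: the packed `Q′*Q′` table as the pointwise product `c·(qV w ⊙ qV w′)` and its total mass (ε1b `PackedAveragingTable`), the words (ε2), the scales (ε3);
anything about Bałaban's tables.  Serves ALSO leaf-04 g22's Ward route (their χ-words `[P_a, χ̂]` have this rank-two shape).
Unit `b2b-balaban-gan24-formalise-leaf-05` (gen 55), G-an2-4 swarm leaf prover 05, road «BF-x» supplier; INTENT «(C3) DIRECT» ε1 (journal).
-/

noncomputable section

namespace Summit.QuantumFields.BalabanUV.Beta.D1BFx.PackedAveragingVertex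

open Finset
open scoped BigOperators
open Literature.MathematicalPhysics.QuantumFieldTheory.Balaban1983to89
open Literature.MathematicalPhysics.QuantumFieldTheory.Balaban1983to89.Beta
open B12Sec2to5 (l1 l1_nonneg)
open B6QGQLower276 (blk B chart mem_B sum_B)
open ExpKernelCalculus (Site MKer Zl Zl_pos l1_sub_triangle l1_sub_symm summable_exp_shift' tsum_exp_shift')
open OneStepResolventKernel (wsum)
open Summit.QuantumFields.BalabanUV.Beta.TameKernelCalculus (trK)
open Summit.QuantumFields.BalabanUV.Beta.D1BFx.GhostStencil (gammaCoeff)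
open Summit.QuantumFields.BalabanUV.Beta.D1BFx.AveragingJetNeedle (gammaCoeff_eq_ite abs_gammaCoeff_le_one)
open Summit.QuantumFields.BalabanUV.Beta.D1BFx.GhostStencilRooted (qJetAt qAntiAt qAntiAt_apply qJetAt_eq_zero)
open Summit.QuantumFields.BalabanUV.Beta.D1BFx.GhostNeedleRootedLetters (sum_B_const')
open Summit.QuantumFields.BalabanUV.Beta.D1BFx.GhostLegMasses (l1_le_of_sameBlk rowFn_unit)
open Summit.QuantumFields.BalabanUV.Beta.D1BFx.CoframeVertices (const_nonneg)
open Summit.QuantumFields.BalabanUV.Beta.D1BFx.KernelMassCalculus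
open Summit.QuantumFields.BalabanUV.Beta.D1BFx.KernelMassTotal

/-! ## §1 The needle count in the bond variable -/

section Needle

variable (n : ℕ) [NeZero n]

omit [NeZero n] in
/-- [folklore] **THE NEEDLE INDICATOR DOMINATES THE CONTOUR COEFFICIENT**: `|γ(κ, u; r, t)| ≤ [u_j = r_j (j < κ), u_j = t_j (j > κ)]` — from the closed form
`AveragingJetNeedle.gammaCoeff_eq_ite` and the unit multiplicity `abs_gammaCoeff_le_one`. -/
theorem abs_gammaCoeff_le_ite (κ : Fin 4) (u r t : Site 4) :
    |gammaCoeff κ u r t| ≤ if (∀ j : Fin 4, j ≠ κ → u j = (if (j : ℕ) < κ then r j else t j)) then (1 : ℝ) else 0 := by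
  by_cases hN : (∀ j : Fin 4, (j : ℕ) < κ → u j = r j) ∧ (∀ j : Fin 4, (κ : ℕ) < j → u j = t j)
  · have hI : ∀ j : Fin 4, j ≠ κ → u j = (if (j : ℕ) < κ then r j else t j) := by
      intro j hj
      by_cases hlt : (j : ℕ) < κ
      · rw [if_pos hlt]; exact hN.1 j hlt
      · rw [if_neg hlt]
        have h1 : (j : ℕ) ≠ κ := fun h => hj (Fin.ext h)
        exact hN.2 j (by omega)
    rw [if_pos hI]
    exact abs_gammaCoeff_le_one κ u r t
  · rw [gammaCoeff_eq_ite, if_neg hN, abs_zero]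
    split_ifs <;> norm_num

/-- [folklore] **THE NEEDLE COUNT IN THE BOND VARIABLE**: for EVERY root `r`, endpoint `t` and block `y`, `Σ_{u ∈ B y} |γ(κ, u; r, t)| ≤ n` — the bonds of the
block met with non-zero multiplicity are pinned in the three coordinates `j ≠ κ`, hence inject into `Fin n` by their `κ`-th local coordinate. -/
theorem sum_B_abs_gammaCoeff_le (κ : Fin 4) (y r t : Site 4) :
    ∑ u ∈ B (n - 1) y, |gammaCoeff κ u r t| ≤ (n : ℝ) := by
  classical
  set c : Fin 4 → ℤ := fun j => if (j : ℕ) < κ then r j else t j with hc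
  have hcardN : (Finset.univ.filter fun z : Fin 4 → Fin (n - 1 + 1) => ∀ j : Fin 4, j ≠ κ → chart (n - 1) y z j = c j).card
      ≤ (Finset.univ : Finset (Fin (n - 1 + 1))).card := by
    refine Finset.card_le_card_of_injOn (fun z : Fin 4 → Fin (n - 1 + 1) => z κ) (fun z _ => Finset.mem_coe.2 (Finset.mem_univ _)) ?_
    intro z hz z' hz' h
    funext j
    by_cases hj : j = κ
    · subst hj; exact h
    · have e1 := (Finset.mem_filter.1 (Finset.mem_coe.1 hz)).2 j hj
      have e2 := (Finset.mem_filter.1 (Finset.mem_coe.1 hz')).2 j hj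
      have e3 : ((z j : ℕ) : ℤ) = ((z' j : ℕ) : ℤ) := by
        have := e1.trans e2.symm
        simp only [chart] at this
        linarith
      exact Fin.ext (by exact_mod_cast e3)
  have hcard : ((Finset.univ.filter fun z : Fin 4 → Fin (n - 1 + 1) => ∀ j : Fin 4, j ≠ κ → chart (n - 1) y z j = c j).card : ℝ)
      ≤ ((Finset.univ : Finset (Fin (n - 1 + 1))).card : ℝ) := by exact_mod_cast hcardN
  calc ∑ u ∈ B (n - 1) y, |gammaCoeff κ u r t|
      ≤ ∑ u ∈ B (n - 1) y, (if (∀ j : Fin 4, j ≠ κ → u j = c j) then (1 : ℝ) else 0) :=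
        Finset.sum_le_sum fun u _ => abs_gammaCoeff_le_ite κ u r t
    _ = ∑ z : Fin 4 → Fin (n - 1 + 1), (if (∀ j : Fin 4, j ≠ κ → chart (n - 1) y z j = c j) then (1 : ℝ) else 0) := sum_B y _
    _ = ((Finset.univ.filter fun z : Fin 4 → Fin (n - 1 + 1) => ∀ j : Fin 4, j ≠ κ → chart (n - 1) y z j = c j).card : ℝ) := by
        rw [Finset.sum_boole]
    _ ≤ ((Finset.univ : Finset (Fin (n - 1 + 1))).card : ℝ) := hcard
    _ = (n : ℝ) := by
        rw [Finset.card_univ, Fintype.card_fin, Nat.sub_add_cancel (NeZero.one_le)]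

end Needle

/-! ## §2 The needle sum of a bond weight family seen from a fine site -/

section NeedleSum

variable (ρ : Site 4) (n : ℕ) [NeZero n] (w : Fin 4 → Site 4 → ℝ)

/-- [our object] **THE NEEDLE SUM** `qF ρ n w t := Σ_κ Σ'_u w κ u·qJetAt ρ n κ u (blk t) t` — the weight family integrated (with the multiplicity `γ∕n⁴`)
along the axial contour from the root of `t`'s block to `t`.  A definition; asserts nothing. -/
def qF (t : Site 4) : ℝ := ∑ κ : Fin 4, ∑' u : Site 4, w κ u * qJetAt ρ n κ u (blk (n - 1) t) t

omit [NeZero n] in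
/-- [folklore] Off the block of `y` the jet term vanishes: `u ∉ B y ⟹ w κ u·qJetAt ρ n κ u y t = 0`. -/
theorem qJet_term_eq_zero (κ : Fin 4) (y t : Site 4) {u : Site 4} (hu : u ∉ B (n - 1) y) :
    w κ u * qJetAt ρ n κ u y t = 0 := by
  rw [qJetAt_eq_zero ρ n κ u (fun h => hu (mem_B.2 h.2)), mul_zero]

omit [NeZero n] in
/-- [folklore] The jet term has finite support (the block), with the block sum as its sum. -/
theorem hasSum_qF_term (κ : Fin 4) (y t : Site 4) :
    HasSum (fun u => w κ u * qJetAt ρ n κ u y t) (∑ u ∈ B (n - 1) y, w κ u * qJetAt ρ n κ u y t) :=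
  hasSum_sum_of_ne_finset_zero fun _ hu => qJet_term_eq_zero ρ n w κ y t hu

omit [NeZero n] in
/-- [folklore] **THE NEEDLE SUM IS A FINITE BLOCK SUM**: `qF ρ n w t = Σ_κ Σ_{u ∈ B(blk t)} w κ u·qJetAt ρ n κ u (blk t) t`. -/
theorem qF_eq_sum (t : Site 4) :
    qF ρ n w t = ∑ κ : Fin 4, ∑ u ∈ B (n - 1) (blk (n - 1) t), w κ u * qJetAt ρ n κ u (blk (n - 1) t) t := by
  unfold qF
  exact Finset.sum_congr rfl fun κ _ => (hasSum_qF_term ρ n w κ _ t).tsum_eq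

/-- [folklore] **THE NEEDLE SUM AGAINST A BLOCKWISE SUP OF THE WEIGHTS**: `|w κ u| ≤ W` on the block of `t` ⟹ `|qF ρ n w t| ≤ 4n·(n⁴)⁻¹·W`
(per direction: weight `≤ W`, multiplicity `n⁻⁴·|γ|`, and §1's count `Σ_{u ∈ B} |γ| ≤ n`). -/
theorem abs_qF_le_of_sup (t : Site 4) {W : ℝ} (hW : ∀ κ, ∀ u ∈ B (n - 1) (blk (n - 1) t), |w κ u| ≤ W) (hW0 : 0 ≤ W) :
    |qF ρ n w t| ≤ 4 * n * ((n : ℝ) ^ 4)⁻¹ * W := by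
  have hn : (0 : ℝ) < n := Nat.cast_pos.2 (Nat.pos_of_ne_zero (NeZero.ne n))
  have h4 : (0 : ℝ) ≤ ((n : ℝ) ^ 4)⁻¹ := inv_nonneg.2 (pow_pos hn 4).le
  set y : Site 4 := blk (n - 1) t with hy
  have hterm : ∀ κ, ∀ u ∈ B (n - 1) y, |w κ u * qJetAt ρ n κ u y t| ≤ W * (((n : ℝ) ^ 4)⁻¹ * |gammaCoeff κ u ((n : ℤ) • y + ρ) t|) := by
    intro κ u hu
    have e : qJetAt ρ n κ u y t = ((n : ℝ) ^ 4)⁻¹ * gammaCoeff κ u ((n : ℤ) • y + ρ) t := by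
      unfold qJetAt; rw [if_pos ⟨hy.symm, mem_B.1 hu⟩]
    rw [e, abs_mul, abs_mul, abs_of_nonneg h4]
    exact mul_le_mul_of_nonneg_right (hW κ u hu) (mul_nonneg h4 (abs_nonneg _))
  rw [qF_eq_sum]
  calc |∑ κ : Fin 4, ∑ u ∈ B (n - 1) y, w κ u * qJetAt ρ n κ u y t|
      ≤ ∑ κ : Fin 4, ∑ u ∈ B (n - 1) y, |w κ u * qJetAt ρ n κ u y t| :=
        (Finset.abs_sum_le_sum_abs _ _).trans (Finset.sum_le_sum fun κ _ => Finset.abs_sum_le_sum_abs _ _)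
    _ ≤ ∑ κ : Fin 4, ∑ u ∈ B (n - 1) y, W * (((n : ℝ) ^ 4)⁻¹ * |gammaCoeff κ u ((n : ℤ) • y + ρ) t|) :=
        Finset.sum_le_sum fun κ _ => Finset.sum_le_sum fun u hu => hterm κ u hu
    _ = ∑ κ : Fin 4, W * ((n : ℝ) ^ 4)⁻¹ * ∑ u ∈ B (n - 1) y, |gammaCoeff κ u ((n : ℤ) • y + ρ) t| := by
        refine Finset.sum_congr rfl fun κ _ => ?_
        rw [Finset.mul_sum]
        exact Finset.sum_congr rfl fun u _ => by ring
    _ ≤ ∑ _κ : Fin 4, W * ((n : ℝ) ^ 4)⁻¹ * (n : ℝ) :=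
        Finset.sum_le_sum fun κ _ => mul_le_mul_of_nonneg_left (sum_B_abs_gammaCoeff_le n κ y _ t) (mul_nonneg hW0 h4)
    _ = 4 * n * ((n : ℝ) ^ 4)⁻¹ * W := by
        simp only [Finset.sum_const, Finset.card_univ, Fintype.card_fin, nsmul_eq_mul]; ring

variable {w} {C δ : ℝ} {P : Site 4}

omit [NeZero n] in
/-- [folklore] **A WEIGHT OF THE BLOCK OF `t`, SEEN FROM `t`**: `|w κ u| ≤ C·e^{−δ|u−P|₁}`, `δ ≥ 0`, `blk u = blk t` ⟹ `|w κ u| ≤ C·e^{4nδ}·e^{−δ|t−P|₁}`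
(two sites of one block are `ℓ¹`-`4n`-close, `GhostLegMasses.l1_le_of_sameBlk`). -/
theorem weight_block_le (hw : ∀ κ u, |w κ u| ≤ C * Real.exp (-δ * l1 (u - P))) (hδ : 0 ≤ δ) (κ : Fin 4) {u t : Site 4}
    (hut : blk (n - 1) u = blk (n - 1) t) :
    |w κ u| ≤ C * Real.exp (4 * n * δ) * Real.exp (-δ * l1 (t - P)) := by
  have hC := const_nonneg hw
  refine (hw κ u).trans ?_
  rw [mul_assoc, ← Real.exp_add]
  refine mul_le_mul_of_nonneg_left (Real.exp_le_exp.2 ?_) hC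
  have h1 : l1 (t - P) ≤ l1 (t - u) + l1 (u - P) := l1_sub_triangle t u P
  have h2 : l1 (t - u) ≤ 4 * (n : ℝ) := l1_le_of_sameBlk n hut.symm
  nlinarith

/-- [folklore] **THE NEEDLE SUM UNDER A LOCALISED WEIGHT ENVELOPE**: `|qF ρ n w t| ≤ 4n·(n⁴)⁻¹·(C·e^{4nδ})·e^{−δ|t−P|₁}` — at the road's dressed weights
(`C = n⁻⁴·C_{G₀}`, `δ = κ′∕4n`) this is `≍ n⁻⁷`, localised at the weights' centre. -/
theorem abs_qF_le (hw : ∀ κ u, |w κ u| ≤ C * Real.exp (-δ * l1 (u - P))) (hδ : 0 ≤ δ) (t : Site 4) :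
    |qF ρ n w t| ≤ 4 * n * ((n : ℝ) ^ 4)⁻¹ * (C * Real.exp (4 * n * δ)) * Real.exp (-δ * l1 (t - P)) := by
  have hC := const_nonneg hw
  have h := abs_qF_le_of_sup ρ n w t (W := C * Real.exp (4 * n * δ) * Real.exp (-δ * l1 (t - P)))
    (fun κ u hu => weight_block_le n hw hδ κ (mem_B.1 hu)) (by positivity)
  linarith [h]

end NeedleSum

/-! ## §3 The packed averaging current: rank two per block -/

section Current

variable (ρ : Site 4) (n : ℕ) [NeZero n] (w : Fin 4 → Site 4 → ℝ)

/-- [our object] **THE PACKED AVERAGING CURRENT** `qV ρ n w := (x z ↦ Σ_κ wsum (w κ) (qAntiAt ρ n κ) x z)` (the `Q′`-vertex of the four words, colour weight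
external).  A definition; asserts nothing. -/
def qV : MKer 4 Unit := fun x z a b => ∑ κ : Fin 4, wsum (w κ) (qAntiAt ρ n κ) x z a b

omit [NeZero n] in
/-- [folklore] **THE RANK-TWO CLOSED FORM**: `qV ρ n w x z = [blk x = blk z]·(qF ρ n w z − qF ρ n w x)`. -/
theorem qV_apply (x z : Site 4) (a b : Unit) :
    qV ρ n w x z a b = if blk (n - 1) x = blk (n - 1) z then qF ρ n w z - qF ρ n w x else 0 := by
  unfold qV wsum
  have eκ : ∀ κ : Fin 4, ∑' u : Site 4, w κ u * qAntiAt ρ n κ u x z a b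
      = (∑' u : Site 4, w κ u * qJetAt ρ n κ u (blk (n - 1) x) z) - ∑' u : Site 4, w κ u * qJetAt ρ n κ u (blk (n - 1) z) x := by
    intro κ
    rw [← (hasSum_qF_term ρ n w κ _ z).summable.tsum_sub (hasSum_qF_term ρ n w κ _ x).summable]
    exact tsum_congr fun u => by rw [qAntiAt_apply, mul_sub]
  simp only [eκ, Finset.sum_sub_distrib]
  by_cases h : blk (n - 1) x = blk (n - 1) z
  · rw [if_pos h]
    unfold qF
    rw [h]
  · rw [if_neg h]
    have h1 : ∀ κ : Fin 4, ∑' u : Site 4, w κ u * qJetAt ρ n κ u (blk (n - 1) x) z = 0 := fun κ => by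
      rw [tsum_congr (fun u => by rw [qJetAt_eq_zero ρ n κ u (fun hh => h hh.1.symm), mul_zero]), tsum_zero]
    have h2 : ∀ κ : Fin 4, ∑' u : Site 4, w κ u * qJetAt ρ n κ u (blk (n - 1) z) x = 0 := fun κ => by
      rw [tsum_congr (fun u => by rw [qJetAt_eq_zero ρ n κ u (fun hh => h hh.1), mul_zero]), tsum_zero]
    simp only [h1, h2, Finset.sum_const_zero, sub_zero]

omit [NeZero n] in
/-- [folklore] Off the common block the packed current vanishes. -/
theorem qV_eq_zero_of_blk_ne {x z : Site 4} (h : blk (n - 1) x ≠ blk (n - 1) z) (a b : Unit) : qV ρ n w x z a b = 0 := by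
  rw [qV_apply, if_neg h]

omit [NeZero n] in
/-- [folklore] The packed averaging current is antisymmetric. -/
theorem qV_antisymm (x z : Site 4) (a b : Unit) : qV ρ n w z x b a = -qV ρ n w x z a b := by
  rw [qV_apply, qV_apply]
  by_cases h : blk (n - 1) x = blk (n - 1) z
  · rw [if_pos h.symm, if_pos h]; ring
  · rw [if_neg (fun hh => h hh.symm), if_neg h, neg_zero]

omit [NeZero n] in
/-- [folklore] … in the road's transpose currency: `trK (qV ρ n w) = −qV ρ n w`. -/
theorem trK_qV : trK (qV ρ n w) = -qV ρ n w := by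
  funext x z a b
  show qV ρ n w z x b a = -qV ρ n w x z a b
  exact qV_antisymm ρ n w x z a b

omit [NeZero n] in
/-- [folklore] The row profile of `qV` is the column profile (antisymmetry). -/
theorem rowFn_qV_swap (x z : Site 4) : rowFn (qV ρ n w) 0 x z = rowFn (qV ρ n w) 0 z x := by
  rw [rowFn_unit, rowFn_unit, qV_antisymm ρ n w z x () (), abs_neg, l1_sub_symm]

omit [NeZero n] in
/-- [folklore] Off the block of `x` the row profile vanishes. -/
theorem rowFn_qV_eq_zero (x : Site 4) {z : Site 4} (hz : z ∉ B (n - 1) (blk (n - 1) x)) : rowFn (qV ρ n w) 0 x z = 0 := by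
  rw [rowFn_unit, qV_eq_zero_of_blk_ne ρ n w (fun h => hz (mem_B.2 h.symm)), abs_zero, zero_mul]

omit [NeZero n] in
/-- [folklore] The row profile has finite support (the block of `x`). -/
theorem hasSum_rowFn_qV (x : Site 4) :
    HasSum (rowFn (qV ρ n w) 0 x) (∑ z ∈ B (n - 1) (blk (n - 1) x), rowFn (qV ρ n w) 0 x z) :=
  hasSum_sum_of_ne_finset_zero fun _ hz => rowFn_qV_eq_zero ρ n w x hz

variable {w} {C δ : ℝ} {P : Site 4}

omit [NeZero n] in
/-- [folklore] `1 ≤ e^{4nδ}` for `δ ≥ 0`. -/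
theorem one_le_exp_block (hδ : 0 ≤ δ) : (1 : ℝ) ≤ Real.exp (4 * n * δ) :=
  Real.one_le_exp (by positivity)

/-- [folklore] **POINTWISE SIZE OF THE PACKED AVERAGING CURRENT**: `|qV ρ n w x z| ≤ 8n·(n⁴)⁻¹·C·e^{8nδ}·e^{−δ|x−P|₁}` (two needle sums of one block;
`≍ n⁻⁷` at the road's weights). -/
theorem abs_qV_le (hw : ∀ κ u, |w κ u| ≤ C * Real.exp (-δ * l1 (u - P))) (hδ : 0 ≤ δ) (x z : Site 4) (a b : Unit) :
    |qV ρ n w x z a b| ≤ 8 * n * ((n : ℝ) ^ 4)⁻¹ * C * Real.exp (8 * n * δ) * Real.exp (-δ * l1 (x - P)) := by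
  have hC := const_nonneg hw
  have hn : (0 : ℝ) < n := Nat.cast_pos.2 (Nat.pos_of_ne_zero (NeZero.ne n))
  have hE : Real.exp (8 * n * δ) = Real.exp (4 * n * δ) * Real.exp (4 * n * δ) := by rw [← Real.exp_add]; ring_nf
  have hA := one_le_exp_block n hδ
  rw [qV_apply]
  by_cases h : blk (n - 1) x = blk (n - 1) z
  · rw [if_pos h]
    have hz := abs_qF_le ρ n hw hδ z
    have hx := abs_qF_le ρ n hw hδ x
    have hzx : Real.exp (-δ * l1 (z - P)) ≤ Real.exp (4 * n * δ) * Real.exp (-δ * l1 (x - P)) := by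
      rw [← Real.exp_add]
      refine Real.exp_le_exp.2 ?_
      have h1 : l1 (x - P) ≤ l1 (x - z) + l1 (z - P) := l1_sub_triangle x z P
      have h2 : l1 (x - z) ≤ 4 * (n : ℝ) := l1_le_of_sameBlk n h
      nlinarith
    have hB : 0 ≤ 4 * n * ((n : ℝ) ^ 4)⁻¹ * (C * Real.exp (4 * n * δ)) := by positivity
    calc |qF ρ n w z - qF ρ n w x| ≤ |qF ρ n w z| + |qF ρ n w x| := abs_sub _ _
      _ ≤ 4 * n * ((n : ℝ) ^ 4)⁻¹ * (C * Real.exp (4 * n * δ)) * (Real.exp (4 * n * δ) * Real.exp (-δ * l1 (x - P)))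
          + 4 * n * ((n : ℝ) ^ 4)⁻¹ * (C * Real.exp (4 * n * δ)) * (Real.exp (4 * n * δ) * Real.exp (-δ * l1 (x - P))) := by
          refine add_le_add (hz.trans (mul_le_mul_of_nonneg_left hzx hB)) (hx.trans (mul_le_mul_of_nonneg_left ?_ hB))
          have hpos : 0 ≤ Real.exp (-δ * l1 (x - P)) := (Real.exp_pos _).le
          nlinarith
      _ = 8 * n * ((n : ℝ) ^ 4)⁻¹ * C * Real.exp (8 * n * δ) * Real.exp (-δ * l1 (x - P)) := by rw [hE]; ring
  · rw [if_neg h, abs_zero]; positivity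

/-- [folklore] **THE ROWS OF THE PACKED AVERAGING CURRENT ARE LOCALISED AT THE WEIGHTS' CENTRE**:
`Σ'_z |qV ρ n w x z| ≤ 8n·C·e^{8nδ}·e^{−δ|x−P|₁}` (`n⁴` entries of a block, each two needle sums; `≍ n⁻³` at the road's weights) — the ROW-vertex shape of
α2's `totMass_sandwich`. -/
theorem rows_qV (hw : ∀ κ u, |w κ u| ≤ C * Real.exp (-δ * l1 (u - P))) (hδ : 0 ≤ δ) (x : Site 4) :
    Summable (rowFn (qV ρ n w) 0 x) ∧ ∑' z, rowFn (qV ρ n w) 0 x z ≤ 8 * n * C * Real.exp (8 * n * δ) * Real.exp (-δ * l1 (x - P)) := by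
  have hn : (0 : ℝ) < n := Nat.cast_pos.2 (Nat.pos_of_ne_zero (NeZero.ne n))
  refine ⟨(hasSum_rowFn_qV ρ n w x).summable, ?_⟩
  rw [(hasSum_rowFn_qV ρ n w x).tsum_eq]
  calc ∑ z ∈ B (n - 1) (blk (n - 1) x), rowFn (qV ρ n w) 0 x z
      ≤ ∑ _z ∈ B (n - 1) (blk (n - 1) x), 8 * n * ((n : ℝ) ^ 4)⁻¹ * C * Real.exp (8 * n * δ) * Real.exp (-δ * l1 (x - P)) :=
        Finset.sum_le_sum fun z _ => by rw [rowFn_unit, l1_sub_symm, zero_mul, Real.exp_zero, mul_one]; exact abs_qV_le ρ n hw hδ x z () ()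
    _ = (n : ℝ) ^ 4 * (8 * n * ((n : ℝ) ^ 4)⁻¹ * C * Real.exp (8 * n * δ) * Real.exp (-δ * l1 (x - P))) := sum_B_const' n _ _
    _ = 8 * n * C * Real.exp (8 * n * δ) * Real.exp (-δ * l1 (x - P)) := by
        field_simp

/-- [folklore] **THE COLUMNS OF THE PACKED AVERAGING CURRENT ARE LOCALISED AT THE WEIGHTS' CENTRE** (antisymmetry):
`Σ'_x |qV ρ n w x z| ≤ 8n·C·e^{8nδ}·e^{−δ|z−P|₁}` — the COLUMN-vertex shape of α2's `totMass_sandwich`. -/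
theorem cols_qV (hw : ∀ κ u, |w κ u| ≤ C * Real.exp (-δ * l1 (u - P))) (hδ : 0 ≤ δ) (z : Site 4) :
    (Summable fun x => rowFn (qV ρ n w) 0 x z) ∧ ∑' x, rowFn (qV ρ n w) 0 x z ≤ 8 * n * C * Real.exp (8 * n * δ) * Real.exp (-δ * l1 (z - P)) := by
  have e : (fun x => rowFn (qV ρ n w) 0 x z) = rowFn (qV ρ n w) 0 z := by funext x; exact (rowFn_qV_swap ρ n w z x).symm
  rw [e]; exact rows_qV ρ n hw hδ z

/-- [folklore] **ROW AND COLUMN MASS OF THE PACKED AVERAGING CURRENT**: `8n·C·e^{8nδ}` (`δ ≥ 0`; `≍ n⁻³` at the road's weights). -/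
theorem masses_qV (hw : ∀ κ u, |w κ u| ≤ C * Real.exp (-δ * l1 (u - P))) (hδ : 0 ≤ δ) :
    RowMass (qV ρ n w) 0 (8 * n * C * Real.exp (8 * n * δ)) ∧ ColMass (qV ρ n w) 0 (8 * n * C * Real.exp (8 * n * δ)) := by
  have hC := const_nonneg hw
  have h8 : 0 ≤ 8 * n * C * Real.exp (8 * n * δ) := by positivity
  have hE : ∀ v : Site 4, 8 * n * C * Real.exp (8 * n * δ) * Real.exp (-δ * l1 (v - P)) ≤ 8 * n * C * Real.exp (8 * n * δ) := fun v => by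
    refine mul_le_of_le_one_right h8 ?_
    rw [Real.exp_le_one_iff]; nlinarith [l1_nonneg (v - P)]
  exact ⟨fun x => ⟨(rows_qV ρ n hw hδ x).1, (rows_qV ρ n hw hδ x).2.trans (hE x)⟩,
    fun z => ⟨(cols_qV ρ n hw hδ z).1, (cols_qV ρ n hw hδ z).2.trans (hE z)⟩⟩

/-- [folklore] **TOTAL MASS OF THE PACKED AVERAGING CURRENT** (`δ > 0`): `Σ'_{(x,z)} |qV ρ n w x z| ≤ 8n·C·e^{8nδ}·Zl 4 δ` (`≍ n` per block at the road's weights: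
the rows summed against the envelope). -/
theorem totMass_qV (hw : ∀ κ u, |w κ u| ≤ C * Real.exp (-δ * l1 (u - P))) (hδ : 0 < δ) :
    TotMass (qV ρ n w) (8 * n * C * Real.exp (8 * n * δ) * Zl 4 δ) := by
  have hrow := fun x => rows_qV ρ n hw hδ.le x
  have hs : Summable fun x => 8 * n * C * Real.exp (8 * n * δ) * Real.exp (-δ * l1 (x - P)) := (summable_exp_shift' hδ P).mul_left _
  have hs' : Summable fun x => ∑' z, rowFn (qV ρ n w) 0 x z :=
    hs.of_nonneg_of_le (fun x => tsum_nonneg fun z => rowFn_nonneg _ _ _ _) (fun x => (hrow x).2)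
  refine totMass_iff.2 ⟨fun x => (hrow x).1, hs', ?_⟩
  calc ∑' x, ∑' z, rowFn (qV ρ n w) 0 x z ≤ ∑' x, 8 * n * C * Real.exp (8 * n * δ) * Real.exp (-δ * l1 (x - P)) :=
        Summable.tsum_le_tsum (fun x => (hrow x).2) hs' hs
    _ = 8 * n * C * Real.exp (8 * n * δ) * Zl 4 δ := by rw [tsum_mul_left, tsum_exp_shift']

end Current

end Summit.QuantumFields.BalabanUV.Beta.D1BFx.PackedAveragingVertex

end
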